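import Summits.Ventures.PercRepro.Night2LocalDQFive

/-!
# PercRepro — the regime `|E ∖ G| = q` with `q − 1` coloops, structure A (night-2, gen 11)

Towards Theorem E's cell `k = q − 1` at `q = 6` (`Night2LocalDQSix.lean`): the structure of a shadow set `S`
with `q − 1` coloops, the first half of `not_two_ex2_of_card_two_penult` with the conclusion `G = S`, the
residual capacity `1` when `G = S`, a loss bound from bounds on `L₁` and `cap`, and the covering preimages
whose added element is a coloop of `M|G` (they are layer-0).

* `eq_of_two_members_card_two`: two distinct members `⊆ S` with series-pair complements and `G ∖ cl Bᵢ = S ∖ Bᵢ`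
  force `G = S`;
* `coverPreimages_self_eq_empty`, `cap2_self_eq_one`: `cap₂(G) = 1`;
* `loss_le_of_L1_le`: `loss ≤ req · (L − c)/L` from `L₁ ≤ L`, `c ≤ cap`;
* `mem_lay0_of_coverSets_coloop`, `rkN_erase_eq_of_nonColoop`, `card_nonColoops_eq_three`.
-/

open scoped Matroid

namespace PercRepro.Shadow

open Finset PerFlat ThmH

variable {α : Type*} [DecidableEq α] {M : Matroid α} [M.Finite]

section Structure

variable {q : ℕ} {G S : Finset α}

/-- **Two distinct members `B₁, B₂ ⊆ S` with series-pair complements and `G ∖ cl Bᵢ = S ∖ Bᵢ` force `G = S`**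
(every `q ≥ 1`, `k = q − 1 = #coloops(S)`, loopless simple `M`): their complements cover the three non-coloops,
`B₁ ∩ B₂` is the coloop set `K`, `B₁ ∪ B₂ = S ∖ w` has rank `q + 1`, and a point `g ∈ G ∖ S` would lie in
`cl B₁ ∩ cl B₂`, forcing `B₁ ∪ B₂ ⊆ cl (K ∪ {g})` of rank `q`. -/
theorem eq_of_two_members_card_two (hq : 1 ≤ q) (hs : ∀ e ∈ gr M, ∀ f ∈ gr M, e ≠ f → rkN M {e, f} = 2)
    (hl : ∀ e ∈ gr M, M.Indep {e}) (hG : G ∈ flatsQ M (q + 1)) (hd : (gr M \ G).card = q)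
    (hk : kColoops M G = q - 1) (hS : S ∈ shadowAt M (q + 2) q (Uq M (q + 2) q) G)
    (ha : (coloops M S).card = q - 1) {B₁ B₂ : Finset α}
    (hB1m : B₁ ∈ membersIn M (Uq M (q + 2) q) G) (hB2m : B₂ ∈ membersIn M (Uq M (q + 2) q) G)
    (hB1S : B₁ ⊆ S) (hB2S : B₂ ⊆ S) (hP1s : S \ B₁ ∈ seriesPairs M S q) (hP2s : S \ B₂ ∈ seriesPairs M S q)
    (hne : B₁ ≠ B₂) (hm1 : G \ clF M B₁ = S \ B₁) (hm2 : G \ clF M B₂ = S \ B₂) : G = S := by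
  classical
  have hSG : S ⊆ G := subset_of_mem_shadowAt hS
  have hGE : G ⊆ gr M := (mem_flatsQ.1 hG).1
  have hSE : S ⊆ gr M := hSG.trans hGE
  have hSr : rkN M S = q + 1 := rkN_eq_of_mem_shadowAt hS
  have hB1U : B₁ ∈ Uq M (q + 2) q := (mem_membersIn.1 hB1m).1
  have hB2U : B₂ ∈ Uq M (q + 2) q := (mem_membersIn.1 hB2m).1
  -- the series pairs P₁, P₂ ⊆ T := nonColoops S
  set P₁ := S \ B₁ with hP₁
  set P₂ := S \ B₂ with hP₂
  have hP1T : P₁ ⊆ nonColoops M S := subset_nonColoops_of_mem_seriesPairs hSE hSr hP1s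
  have hP2T : P₂ ⊆ nonColoops M S := subset_nonColoops_of_mem_seriesPairs hSE hSr hP2s
  have hc1 : P₁.card = 2 := by
    obtain ⟨x, y, hxy, hP, -⟩ := exists_pair_of_mem_seriesPairs hP1s
    rw [hP]; exact Finset.card_pair hxy
  have hc2 : P₂.card = 2 := by
    obtain ⟨x, y, hxy, hP, -⟩ := exists_pair_of_mem_seriesPairs hP2s
    rw [hP]; exact Finset.card_pair hxy
  have hB1eq : B₁ = S \ P₁ := (Finset.sdiff_sdiff_eq_self hB1S).symm
  have hB2eq : B₂ = S \ P₂ := (Finset.sdiff_sdiff_eq_self hB2S).symm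
  have hPne : P₁ ≠ P₂ := fun h => hne (by rw [hB1eq, hB2eq, h])
  -- |T| ≤ 3 : ρ(T ∖ P₁) = 1
  obtain ⟨x, y, hxy, hPxy, hser⟩ := exists_pair_of_mem_seriesPairs hP1s
  have hT1 : rkN M (nonColoops M S \ P₁) = 1 := by
    have hunion : coloops M S ∪ (nonColoops M S \ P₁) = S \ P₁ := by
      ext e
      simp only [Finset.mem_union, Finset.mem_sdiff, nonColoops]
      constructor
      · rintro (he | ⟨⟨heS, -⟩, heP⟩)
        · exact ⟨coloops_subset_self S he, fun heP => (Finset.mem_sdiff.1 (hP1T heP)).2 he⟩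
        · exact ⟨heS, heP⟩
      · rintro ⟨heS, heP⟩
        by_cases hc : e ∈ coloops M S
        · exact Or.inl hc
        · exact Or.inr ⟨⟨heS, hc⟩, heP⟩
    have h := eRk_union_coloops hSE (coloops M S) (fun y hy => mem_coloops.1 hy)
      (X := nonColoops M S \ P₁) (Finset.sdiff_subset.trans Finset.sdiff_subset)
      (Finset.disjoint_of_subset_right Finset.sdiff_subset Finset.disjoint_sdiff)
    rw [hunion, ha, eRk_eq_rkN, eRk_eq_rkN] at h
    have hr4 : rkN M (S \ P₁) = q := by rw [hPxy]; exact hser.2.2.2.2.2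
    rw [hr4] at h
    have h' : q = q - 1 + rkN M (nonColoops M S \ P₁) := by exact_mod_cast h
    omega
  have hT3 : (nonColoops M S).card ≤ 3 := by
    have hle : (nonColoops M S \ P₁).card ≤ 1 := by
      apply card_le_one_of_eRk_le_one hs (X := nonColoops M S \ P₁)
        (Finset.sdiff_subset.trans (Finset.sdiff_subset.trans hSE))
      rw [eRk_eq_rkN, hT1]
      exact le_rfl
    have := Finset.card_sdiff_add_card_eq_card hP1T
    omega
  -- P₁ ∩ P₂ = {w}, P₁ ∪ P₂ = T
  have hcU : (P₁ ∪ P₂).card ≤ 3 := (Finset.card_le_card (Finset.union_subset hP1T hP2T)).trans hT3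
  have hUI := Finset.card_union_add_card_inter P₁ P₂
  have hI1 : (P₁ ∩ P₂).card ≤ 1 := by
    by_contra hlt
    push Not at hlt
    have hsub : P₁ ∩ P₂ ⊆ P₁ := Finset.inter_subset_left
    have heq : P₁ ∩ P₂ = P₁ := Finset.eq_of_subset_of_card_le hsub (by omega)
    have h12 : P₁ ⊆ P₂ := by rw [← heq]; exact Finset.inter_subset_right
    exact hPne (Finset.eq_of_subset_of_card_le h12 (by omega))
  have hIcard : (P₁ ∩ P₂).card = 1 := by omega
  obtain ⟨w, hw⟩ := Finset.card_eq_one.1 hIcard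
  have hUT : P₁ ∪ P₂ = nonColoops M S :=
    Finset.eq_of_subset_of_card_le (Finset.union_subset hP1T hP2T) (by omega)
  -- B₁ ∪ B₂ = S ∖ {w} has rank 5; B₁ ∩ B₂ = coloops S
  have hwP : w ∈ P₁ := Finset.inter_subset_left (hw ▸ Finset.mem_singleton_self w)
  have hrw : rkN M (S.erase w) = q + 1 := by
    rw [hPxy, Finset.mem_insert, Finset.mem_singleton] at hwP
    rcases hwP with rfl | rfl
    · exact hser.2.2.2.1
    · exact hser.2.2.2.2.1
  have hBU : B₁ ∪ B₂ = S.erase w := by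
    rw [hB1eq, hB2eq, ← Finset.sdiff_inter_distrib_right, hw, Finset.sdiff_singleton_eq_erase]
  have hBI : B₁ ∩ B₂ = coloops M S := by
    rw [hB1eq, hB2eq, ← Finset.sdiff_union_distrib, hUT]
    unfold nonColoops
    exact Finset.sdiff_sdiff_eq_self (coloops_subset_self S)
  -- G ⊆ S
  have hGS : G ⊆ S := by
    intro g hg
    by_contra hgS
    have hg1 : g ∈ clF M B₁ := by
      by_contra h
      have : g ∈ P₁ := by rw [← hm1]; exact Finset.mem_sdiff.2 ⟨hg, h⟩
      rw [hP₁] at this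
      exact hgS (Finset.mem_sdiff.1 this).1
    have hg2 : g ∈ clF M B₂ := by
      by_contra h
      have : g ∈ P₂ := by rw [← hm2]; exact Finset.mem_sdiff.2 ⟨hg, h⟩
      rw [hP₂] at this
      exact hgS (Finset.mem_sdiff.1 this).1
    -- K ∪ {g} has rank 4
    have hK : coloops M S = G.filter (fun y => y ∉ clF M (G.erase y)) :=
      coloops_eq_filter_of_card hS (by rw [ha, hk])
    have hKg : rkN M (coloops M S ∪ {g}) = q := by
      have h := eRk_union_coloops hGE (coloops M S)
        (fun y hy => by rw [hK, Finset.mem_filter] at hy; exact hy) (X := {g})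
        (Finset.singleton_subset_iff.2 hg)
        (Finset.disjoint_singleton_right.2 (fun h => hgS (coloops_subset_self S h)))
      have hg1' : M.eRk (({g} : Finset α) : Set α) = 1 := by
        rw [Finset.coe_singleton, (hl g (hGE hg)).eRk_eq_encard, Set.encard_singleton]
      rw [ha, hg1', eRk_eq_rkN] at h
      have h' : rkN M (coloops M S ∪ {g}) = q - 1 + 1 := by exact_mod_cast h
      omega
    -- B_i ⊆ cl (K ∪ {g})
    have hKsub : ∀ B ∈ ({B₁, B₂} : Finset (Finset α)), coloops M S ⊆ B := by
      intro B hB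
      rw [Finset.mem_insert, Finset.mem_singleton] at hB
      rcases hB with rfl | rfl
      · rw [← hBI]; exact Finset.inter_subset_left
      · rw [← hBI]; exact Finset.inter_subset_right
    have hcl : ∀ B, B ∈ Uq M (q + 2) q → coloops M S ⊆ B → g ∈ clF M B →
        (B : Set α) ⊆ M.closure ((coloops M S ∪ {g} : Finset α) : Set α) := by
      intro B hBU hKB hgB
      have hBE : B ⊆ gr M := (mem_Uq.1 hBU).1
      have hX : B ∪ (coloops M S ∪ {g}) ⊆ gr M :=
        Finset.union_subset hBE (Finset.union_subset (hKB.trans hBE) (Finset.singleton_subset_iff.2 (hGE hg)))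
      have hXcl : B ∪ (coloops M S ∪ {g}) ⊆ clF M B := by
        apply Finset.union_subset (subset_clF_of_subset_gr hBE)
        apply Finset.union_subset (hKB.trans (subset_clF_of_subset_gr hBE))
        exact Finset.singleton_subset_iff.2 hgB
      have hr : rkN M (coloops M S ∪ {g}) = rkN M (B ∪ (coloops M S ∪ {g})) := by
        apply le_antisymm (rkN_mono Finset.subset_union_right)
        rw [hKg]
        exact rkN_le_of_subset_clF hBU hXcl
      exact (Finset.coe_subset.2 Finset.subset_union_left).trans
        (subset_closure_of_rkN_eq hX Finset.subset_union_right hr)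
    have hsub : ((B₁ ∪ B₂ : Finset α) : Set α) ⊆ M.closure ((coloops M S ∪ {g} : Finset α) : Set α) := by
      rw [Finset.coe_union]
      exact Set.union_subset (hcl B₁ hB1U (hKsub B₁ (by simp)) hg1) (hcl B₂ hB2U (hKsub B₂ (by simp)) hg2)
    have hle : M.eRk ((B₁ ∪ B₂ : Finset α) : Set α) ≤ M.eRk ((coloops M S ∪ {g} : Finset α) : Set α) := by
      calc M.eRk ((B₁ ∪ B₂ : Finset α) : Set α)
          ≤ M.eRk (M.closure ((coloops M S ∪ {g} : Finset α) : Set α)) := M.eRk_mono hsub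
        _ = _ := M.eRk_closure_eq _
    rw [hBU, eRk_eq_rkN, eRk_eq_rkN, hrw, hKg] at hle
    have : (q + 1 : ℕ) ≤ q := by exact_mod_cast hle
    omega
  exact Finset.Subset.antisymm hGS hSG

/-- A covering preimage of `G` itself is impossible at `d = q`: it would be `G ∖ x` with the complement
`(E ∖ G) ∪ {x}` of `≤ q + 1` elements. -/
theorem coverPreimages_self_eq_empty (hd : (gr M \ G).card = q) :
    coverPreimages M (Uq M (q + 2) q) G G = ∅ := by
  rw [Finset.eq_empty_iff_forall_notMem]
  intro B hB
  rw [mem_coverPreimages] at hB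
  obtain ⟨hBm, hcov⟩ := hB
  obtain ⟨y, hy, hyS⟩ := mem_coverSets.1 hcov
  have hBU : B ∈ Uq M (q + 2) q := (mem_membersIn.1 hBm).1
  have hyB : y ∉ B := notMem_of_notMem_clF hBU (Finset.mem_sdiff.1 hy).2
  have hBeq : B = G.erase y := by rw [← hyS, Finset.erase_insert hyB]
  have hcompl : gr M \ B ⊆ insert y (gr M \ G) := by
    intro e he
    rw [Finset.mem_sdiff, hBeq, Finset.mem_erase] at he
    rw [Finset.mem_insert, Finset.mem_sdiff]
    by_cases hey : e = y
    · exact Or.inl hey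
    · exact Or.inr ⟨he.1, fun heG => he.2 ⟨hey, heG⟩⟩
  have hcard : (gr M \ B).card ≤ q + 1 := by
    calc (gr M \ B).card ≤ (insert y (gr M \ G)).card := Finset.card_le_card hcompl
      _ ≤ (gr M \ G).card + 1 := Finset.card_insert_le _ _
      _ = q + 1 := by rw [hd]
  have hr : M.eRk ((gr M \ B : Finset α) : Set α) = ((q + 2 : ℕ) : ℕ∞) := (mem_Uq.1 hBU).2.2
  have hle : M.eRk ((gr M \ B : Finset α) : Set α) ≤ ((gr M \ B).card : ℕ∞) := by
    rw [← Set.encard_coe_eq_coe_finsetCard]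
    exact M.eRk_le_encard _
  rw [hr] at hle
  have : (q + 2 : ℕ) ≤ (gr M \ B).card := by exact_mod_cast hle
  omega

open scoped Classical in
/-- When the shadow set is `G` itself, nothing is requested from it: `cap₂(G) = 1`. -/
theorem cap2_self_eq_one (hd : (gr M \ G).card = q) : cap2 M q G G = 1 := by
  have hk1 : k1 M q G G = 0 := by
    unfold k1
    rw [coverPreimages_self_eq_empty hd, Finset.filter_empty, Finset.card_empty]
  have hL1 : L1 M q G G = 0 := by
    unfold L1
    rw [coverPreimages_self_eq_empty hd, Finset.filter_empty, Finset.sum_empty]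
  have hcap : capS M q G G = 1 := by
    unfold capS
    rw [hk1, Nat.cast_zero, zero_mul, zero_div, sub_zero]
  unfold cap2 fS
  rw [hL1, hcap]
  simp

/-- The loss of a member at a covering set from an upper bound `L` on `L₁` and a lower bound `c` on `cap`. -/
theorem loss_le_of_L1_le {B : Finset α} {z : α} {L c : ℚ} (hL : L1 M q G (insert z B) ≤ L)
    (hc : c ≤ capS M q G (insert z B)) (hc0 : 0 < c) (hcL : c ≤ L) :
    loss M q G B z ≤ req M q B * ((L - c) / L) := by
  have hreq : 0 ≤ req M q B := req_nonneg q B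
  have hLpos : 0 < L := hc0.trans_le hcL
  have hrhs : 0 ≤ (L - c) / L := div_nonneg (by linarith) hLpos.le
  unfold loss fS
  split_ifs with hle
  · rw [sub_self, mul_zero]
    exact mul_nonneg hreq hrhs
  · push Not at hle
    have hL1pos : 0 < L1 M q G (insert z B) := hc0.trans_le (hc.trans hle.le)
    have h1 : 1 - capS M q G (insert z B) / L1 M q G (insert z B) =
        (L1 M q G (insert z B) - capS M q G (insert z B)) / L1 M q G (insert z B) := by
      field_simp
    rw [h1]
    apply mul_le_mul_of_nonneg_left _ hreq
    calc (L1 M q G (insert z B) - capS M q G (insert z B)) / L1 M q G (insert z B)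
        ≤ (L1 M q G (insert z B) - c) / L1 M q G (insert z B) := by
          apply div_le_div_of_nonneg_right _ hL1pos.le
          linarith
      _ ≤ (L - c) / L := ratio_mono hc0.le hL1pos hL

/-- A covering preimage of a shadow set whose added element `x` is a coloop of `M|G` is a layer-0 member
(`d = q`): `cl B = G ∖ x`. -/
theorem mem_lay0_of_coverSets_coloop (hG : G ∈ flatsQ M (q + 1)) (hd : (gr M \ G).card = q)
    {B : Finset α} (hBm : B ∈ membersIn M (Uq M (q + 2) q) G) {x : α} (hx : x ∈ G \ clF M B)
    (hxc : x ∉ clF M (G.erase x)) : B ∈ lay0 M q G := by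
  have hGE : G ⊆ gr M := (mem_flatsQ.1 hG).1
  have hBU := (mem_membersIn.1 hBm).1
  have hBG : clF M B ⊆ G := (mem_membersIn.1 hBm).2
  have hBE : B ⊆ gr M := (mem_Uq.1 hBU).1
  have hxG : x ∈ G := (Finset.mem_sdiff.1 hx).1
  have hxcl : x ∉ clF M B := (Finset.mem_sdiff.1 hx).2
  have hxB : x ∉ B := notMem_of_notMem_clF hBU hxcl
  have hBsub : B ⊆ G.erase x := Finset.subset_erase.2 ⟨(subset_clF_of_subset_gr hBE).trans hBG, hxB⟩
  -- rank of G ∖ x is q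
  have hrGx : rkN M (G.erase x) = q := by
    have h := eRk_insert_of_notMem_clF_erase hGE hxG hxc (X := G.erase x) (Finset.Subset.refl _)
    rw [Finset.insert_erase hxG, (mem_flatsQ.1 hG).2.2, eRk_eq_rkN] at h
    have h' : q + 1 = rkN M (G.erase x) + 1 := by exact_mod_cast h
    omega
  have hrB : rkN M B = q := by
    have := (mem_Uq.1 hBU).2.1
    rw [eRk_eq_rkN] at this
    exact_mod_cast this
  have hcl2 : G.erase x ⊆ clF M B := by
    have := subset_closure_of_rkN_eq ((Finset.erase_subset x G).trans hGE) hBsub (by rw [hrB, hrGx])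
    intro e he
    rw [← Finset.mem_coe, coe_clF]
    exact this (Finset.mem_coe.2 he)
  have hsing : G \ clF M B = {x} := by
    ext e
    rw [Finset.mem_sdiff, Finset.mem_singleton]
    constructor
    · rintro ⟨heG, hecl⟩
      by_contra hne
      exact hecl (hcl2 (Finset.mem_erase.2 ⟨hne, heG⟩))
    · rintro rfl
      exact ⟨hxG, hxcl⟩
  rw [mem_lay0, hsing, Finset.card_singleton]
  exact ⟨hBm, rfl, by omega⟩

/-- A non-coloop `x` of `S` keeps the rank: `ρ(S ∖ x) = ρ(S)`. -/
theorem rkN_erase_eq_of_nonColoop {x : α} (hxS : x ∈ S) (hx : x ∉ coloops M S) :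
    rkN M (S.erase x) = rkN M S := by
  rw [mem_coloops] at hx
  have hcl : x ∈ clF M (S.erase x) := by
    by_contra h
    exact hx ⟨hxS, h⟩
  have hcl' : x ∈ M.closure ((S.erase x : Finset α) : Set α) := by
    rw [← coe_clF]; exact_mod_cast hcl
  have h : M.eRk (insert x ((S.erase x : Finset α) : Set α)) = M.eRk ((S.erase x : Finset α) : Set α) := by
    rw [← Matroid.eRk_insert_closure_eq, Set.insert_eq_of_mem hcl', Matroid.eRk_closure_eq]
  rw [← Finset.coe_insert, Finset.insert_erase hxS, eRk_eq_rkN, eRk_eq_rkN] at h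
  exact_mod_cast h.symm

/-- With `q − 1` coloops and a series pair, the non-coloops number exactly `3`. -/
theorem card_nonColoops_eq_three (hs : ∀ e ∈ gr M, ∀ f ∈ gr M, e ≠ f → rkN M {e, f} = 2)
    (hG : G ∈ flatsQ M (q + 1)) (hS : S ∈ shadowAt M (q + 2) q (Uq M (q + 2) q) G)
    (ha : (coloops M S).card = q - 1) (hq : 1 ≤ q) {P : Finset α} (hP : P ∈ seriesPairs M S q) :
    (nonColoops M S).card = 3 := by
  have hSG : S ⊆ G := subset_of_mem_shadowAt hS
  have hSE : S ⊆ gr M := hSG.trans (mem_flatsQ.1 hG).1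
  have hSr : rkN M S = q + 1 := rkN_eq_of_mem_shadowAt hS
  have hPT : P ⊆ nonColoops M S := subset_nonColoops_of_mem_seriesPairs hSE hSr hP
  obtain ⟨x, y, hxy, hPxy, hser⟩ := exists_pair_of_mem_seriesPairs hP
  have hc : P.card = 2 := by rw [hPxy]; exact Finset.card_pair hxy
  have hT1 : rkN M (nonColoops M S \ P) = 1 := by
    have hunion : coloops M S ∪ (nonColoops M S \ P) = S \ P := by
      ext e
      simp only [Finset.mem_union, Finset.mem_sdiff, nonColoops]
      constructor
      · rintro (he | ⟨⟨heS, -⟩, heP⟩)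
        · exact ⟨coloops_subset_self S he, fun heP => (Finset.mem_sdiff.1 (hPT heP)).2 he⟩
        · exact ⟨heS, heP⟩
      · rintro ⟨heS, heP⟩
        by_cases hc : e ∈ coloops M S
        · exact Or.inl hc
        · exact Or.inr ⟨⟨heS, hc⟩, heP⟩
    have h := eRk_union_coloops hSE (coloops M S) (fun y hy => mem_coloops.1 hy)
      (X := nonColoops M S \ P) (Finset.sdiff_subset.trans Finset.sdiff_subset)
      (Finset.disjoint_of_subset_right Finset.sdiff_subset Finset.disjoint_sdiff)
    rw [hunion, ha, eRk_eq_rkN, eRk_eq_rkN] at h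
    have hr : rkN M (S \ P) = q := by rw [hPxy]; exact hser.2.2.2.2.2
    rw [hr] at h
    have h' : q = q - 1 + rkN M (nonColoops M S \ P) := by exact_mod_cast h
    omega
  have hle : (nonColoops M S \ P).card ≤ 1 := by
    apply card_le_one_of_eRk_le_one hs (X := nonColoops M S \ P)
      (Finset.sdiff_subset.trans (Finset.sdiff_subset.trans hSE))
    rw [eRk_eq_rkN, hT1]
    exact le_rfl
  have hne : (nonColoops M S \ P).Nonempty := by
    rw [Finset.nonempty_iff_ne_empty]
    intro h
    rw [h] at hT1
    unfold rkN at hT1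
    simp at hT1
  have hge : 1 ≤ (nonColoops M S \ P).card := Finset.card_pos.2 hne
  have := Finset.card_sdiff_add_card_eq_card hPT
  omega

end Structure

end PercRepro.Shadow
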